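import Summits.BirchSwinnertonDyer.BirchSwinnertonDyer.Theorems.UniversalToricDescentRationalSplitIMCInclusionAtThreeClosedModuloV3
import Summits.BirchSwinnertonDyer.BirchSwinnertonDyer.Theorems.EisensteinPrimesPoitouTateShaNaturalAtTC
import HarnessLib

/-!
# Line `ratwall_thin_comb` v4 on the RATIONAL WALL `RationalSplitIMCInclusionAtThree` (stmt-BirchSwinnertonDyer-24207) — the crux CLOSED
# MODULO ITS TWO RESEARCH STUBS ONLY: K3a♯ (toric two-variable 3-adic `L`-function up to a constant) and K2-rat⊕K4⊕K3(iii)♯ (weak reflection +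
# rational thin-comb divisibility); NO print input is left (helper, `--supports stmt-BirchSwinnertonDyer-24207`; cell `pub/bsd-wall`, lead `cruxlead-24207` g2)

`…ClosedModuloV3.RationalSplitIMCInclusionAtThree_of_toricExistsUpTo_of_ratCombDivisibilityUpTo_of_poitouTateAt` (lead g0, p732846) gave the crux
BY NAME from K3a♯, K2♯ and ONE textbook statement — the natural restricted Poitou–Tate `Ш`-duality at finite `S` of totally complex fields,
`∀ L [IsTotallyComplex L] S, S.Finite → GaloisCohomology.poitouTate_shaRestricted_tateDual_natural_at L S` (Milne ADT I Thm. 4.10 (a)), the only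
input of `stub_noPseudoNull`. That statement is now a TREE THEOREM — the END theorem of the cell `bsd-eis` lane «PT-Ш-S-TC»,
`…Theorems.PoitouTateShaNaturalAtTC.forall_poitouTate_shaRestricted_tateDual_natural_at_of_isTotallyComplex` (p735406, 2026-08-29) — so this file
discharges it: `RationalSplitIMCInclusionAtThree_of_toricExistsUpTo_of_ratCombDivisibilityUpTo` is the rational wall from EXACTLY the two
registered research stubs of skeleton v4 (`Cruxes/RationalSplitIMCInclusionAtThree/Lines/ratwall_thin_comb.lean`), as hypotheses VERBATIM:

* `hK3a` = `stub_toricExistsUpTo` (∃ ♯-frame: `∃ ΩK′ Ωp′ C L₂, ΩK′ ≠ 0 ∧ Ωp′ ≠ 0 ∧ C ≠ 0 ∧ IsToricTwoVarLFunctionUpTo C …`; print-adjacent —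
  Hida 1988 AIF Thm. 5.1b at `p ≥ 5` WITH its congruence denominator; the bounded-denominator adaptation at the additive split 3 is research);
* `hK2` = `stub_ratCombDivisibilityUpTo` (∀ ♯-frames: weak reflection `ρ` fixing constants with `ρ T₂ ∉ (3, T₂)`, `ρ G ∼ G` (K4), `ρ L₂ ∼ L₂` (K3(iii))
  and `ThinCombDvdRat R₀ 3 G L₂` (K2 with per-tooth slack) — research; beyond print at the p-adic Beilinson value formula with `3 ∣ N`).

So, as of v4: 24207 `RationalSplitIMCInclusionAtThree` = research {K3a♯, K2-rat⊕K4⊕K3(iii)♯} ⊕ print {∅}. Everything else in the line (frame,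
principal generator, torsion dichotomy, ♯ cross-period rigidity, line congruence, weak-reflection rigidity, no-pseudo-null, rational descent
p703976) is a tree theorem. HONEST FRAMING: conditional (closure.modulo) on two research statements for which this file is no evidence; it
credits nothing by itself; no summit statement and no case of BSD is proved; 24207 OPEN.
-/

set_option linter.dupNamespace false
set_option autoImplicit false

noncomputable section

open scoped Classical

namespace Summit.BirchSwinnertonDyer.BirchSwinnertonDyer.Theorems.UniversalToricDescentRatwallThinCombLine

open NumberField IsDedekindDomain Field
open Literature.NumberTheory.EllipticCurves Literature.NumberTheory.GaloisRepresentations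
open Literature.NumberTheory.GaloisCohomology
open Summit.BirchSwinnertonDyer.BirchSwinnertonDyer.Theorems.UniversalToricDescentThinComb

/-- **The rational wall from its two research stubs ALONE** (skeleton `ratwall_thin_comb` v4): K3a♯ `stub_toricExistsUpTo` and
K2-rat⊕K4⊕K3(iii)♯ `stub_ratCombDivisibilityUpTo` as hypotheses VERBATIM, composed by
`…ClosedModuloV3.RationalSplitIMCInclusionAtThree_of_toricExistsUpTo_of_ratCombDivisibilityUpTo_of_poitouTateAt` with its third hypothesis
(Milne ADT I Thm. 4.10 (a) at finite `S` of totally complex fields) DISCHARGED by the tree theorem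
`PoitouTateShaNaturalAtTC.forall_poitouTate_shaRestricted_tateDual_natural_at_of_isTotallyComplex`. Conditional; closes nothing by itself.
[cite: MilneADT2006, I Thm. 4.10 (a) (p. 57)] [cite: CastellaWan2023, §2.4 Thm. 2.11, Cor. 2.12] [cite: Hida1988AIF, Thm. 5.1b (doi:10.5802/aif.1141)]
[cite: KingsLoefflerZerbes2017, Thm. 11.6.4] -/
theorem RationalSplitIMCInclusionAtThree_of_toricExistsUpTo_of_ratCombDivisibilityUpTo
    (hK3a :
        ∀ (W : WeierstrassCurve ℚ) [W.IsElliptic] [W.IsGloballyMinimal] (N : ℕ) [NeZero N] (K : Type) [Field K]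
          [NumberField K] (Dt : Literature.NumberTheory.EllipticCurves.ModularForms.ModularParametrizationData W N),
        Summit.BirchSwinnertonDyer.Rank1Residual.Additive.ClassO6 W 3 → W.HasSurjectiveModNGaloisRep 3 →
        W.analyticRank = 1 → W.conductorNorm ℤ = N → IsImaginaryQuadratic K → SatisfiesHeegnerHypothesis N K →
        ∀ (κ : ZpExtension K 3), κ.IsAnticyclotomic → ∀ (γ : Field.absoluteGaloisGroup K) [Fact (κ.IsTopGenerator γ)]
          (𝔭 : HeightOneSpectrum (𝓞 K)), ((3 : ℕ) : 𝓞 K) ∈ 𝔭.asIdeal →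
          𝔭.asIdeal.ramificationIdx (𝓞 ℚ) = 1 → 𝔭.asIdeal.inertiaDeg (𝓞 ℚ) = 1 →
        ∀ (𝔭' : HeightOneSpectrum (𝓞 K)), ((3 : ℕ) : 𝓞 K) ∈ 𝔭'.asIdeal → 𝔭' ≠ 𝔭 →
        ∀ (ι' : PadicAlgCl 3 ≃+* ℂ), Summit.BirchSwinnertonDyer.BirchSwinnertonDyer.Theorems.SchneiderFree.BranchInducesPrime 3 ι' 𝔭 →
        ∀ (κ₁ κ₂ : ZpExtension K 3) (γ₁ γ₂ : Field.absoluteGaloisGroup K) (k : ℕ)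
          [Fact (ZpExtension.IsTopGeneratorPair κ₁ κ₂ γ₁ γ₂)],
        (∀ v : HeightOneSpectrum (𝓞 K), v ≠ 𝔭 → ∀ 𝔓 ∈ v.primesAbove,
            𝔓.inertia (Field.absoluteGaloisGroup K) ≤ κ₁.kerSubgroup) →
        ZpExtension.pairKer κ₁ κ₂ ≤ κ.kerSubgroup → γ₁ * γ⁻¹ ∈ κ.kerSubgroup → γ₂ * (γ ^ (3 ^ k))⁻¹ ∈ κ.kerSubgroup →
        ∃ (ΩK' : ℂ) (Ωp' : ℂ_[3]) (C : ℂ_[3]) (L₂ : PowerSeries (PowerSeries (unrIntegers 3))),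
          ΩK' ≠ 0 ∧ Ωp' ≠ 0 ∧ C ≠ 0 ∧ IsToricTwoVarLFunctionUpTo C ι' 𝔭 𝔭' κ₁ κ₂ γ₁ γ₂ Dt.f ΩK' Ωp' L₂ )
    (hK2 :
        ∀ (W : WeierstrassCurve ℚ) [W.IsElliptic] [W.IsGloballyMinimal] (N : ℕ) [NeZero N] (K : Type) [Field K]
          [NumberField K] (Dt : Literature.NumberTheory.EllipticCurves.ModularForms.ModularParametrizationData W N),
        Summit.BirchSwinnertonDyer.Rank1Residual.Additive.ClassO6 W 3 → W.HasSurjectiveModNGaloisRep 3 →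
        W.analyticRank = 1 → W.conductorNorm ℤ = N → IsImaginaryQuadratic K → SatisfiesHeegnerHypothesis N K →
        ∀ (𝔭 : HeightOneSpectrum (𝓞 K)), ((3 : ℕ) : 𝓞 K) ∈ 𝔭.asIdeal →
          𝔭.asIdeal.ramificationIdx (𝓞 ℚ) = 1 → 𝔭.asIdeal.inertiaDeg (𝓞 ℚ) = 1 →
        ∀ (𝔭' : HeightOneSpectrum (𝓞 K)), ((3 : ℕ) : 𝓞 K) ∈ 𝔭'.asIdeal → 𝔭' ≠ 𝔭 →
        ∀ (ι' : PadicAlgCl 3 ≃+* ℂ), Summit.BirchSwinnertonDyer.BirchSwinnertonDyer.Theorems.SchneiderFree.BranchInducesPrime 3 ι' 𝔭 →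
        ∀ (κ₁ κ₂ : ZpExtension K 3) (γ₁ γ₂ : Field.absoluteGaloisGroup K)
          [Fact (ZpExtension.IsTopGeneratorPair κ₁ κ₂ γ₁ γ₂)],
        (∀ v : HeightOneSpectrum (𝓞 K), v ≠ 𝔭 → ∀ 𝔓 ∈ v.primesAbove,
            𝔓.inertia (Field.absoluteGaloisGroup K) ≤ κ₁.kerSubgroup) →
        ∀ (g : IwasawaAlgebra₂ 3),
          Literature.NumberTheory.EllipticCurves.Module.charIdeal (IwasawaAlgebra₂ 3)
            ((W.baseChange K).XGr₂ 3 κ₁ κ₂ 𝔭' γ₁ γ₂) = Ideal.span {g} →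
        ∀ (ΩK : ℂ) (Ωp : ℂ_[3]) (C : ℂ_[3]) (L₂ : PowerSeries (PowerSeries (unrIntegers 3))), ΩK ≠ 0 → Ωp ≠ 0 → C ≠ 0 →
          IsToricTwoVarLFunctionUpTo C ι' 𝔭 𝔭' κ₁ κ₂ γ₁ γ₂ Dt.f ΩK Ωp L₂ →
        ∃ (ρ : PowerSeries (PowerSeries (unrIntegers 3)) ≃+* PowerSeries (PowerSeries (unrIntegers 3))),
          (∀ c : unrIntegers 3, ρ (const (unrIntegers 3) c) = const (unrIntegers 3) c) ∧
          ρ (T₂ (unrIntegers 3)) ∉ Ideal.span {const (unrIntegers 3) ((3 : ℕ) : unrIntegers 3), T₂ (unrIntegers 3)} ∧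
          Associated (ρ (PowerSeries.map (PowerSeries.map
            (Summit.BirchSwinnertonDyer.Rank1Residual.X11b.Halves.toUnr 3)) g))
            (PowerSeries.map (PowerSeries.map (Summit.BirchSwinnertonDyer.Rank1Residual.X11b.Halves.toUnr 3)) g) ∧
          Associated (ρ L₂) L₂ ∧
          ThinCombDvdRat (unrIntegers 3) 3
            (PowerSeries.map (PowerSeries.map (Summit.BirchSwinnertonDyer.Rank1Residual.X11b.Halves.toUnr 3)) g) L₂ ) :
    Summit.BirchSwinnertonDyer.BirchSwinnertonDyer.Theses.UniversalToricDescent.RationalSplitIMCInclusionAtThree :=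
  RationalSplitIMCInclusionAtThree_of_toricExistsUpTo_of_ratCombDivisibilityUpTo_of_poitouTateAt hK3a hK2
    Summit.BirchSwinnertonDyer.BirchSwinnertonDyer.Theorems.PoitouTateShaNaturalAtTC.forall_poitouTate_shaRestricted_tateDual_natural_at_of_isTotallyComplex

end Summit.BirchSwinnertonDyer.BirchSwinnertonDyer.Theorems.UniversalToricDescentRatwallThinCombLine

end
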